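import Literature.NumberTheory.NumberFields.HilbertClassFieldCorrespondence
import Literature.NumberTheory.NumberFields.HilbertClassFieldArtinEquivariance
import Literature.NumberTheory.NumberFields.HilbertClassFieldOfGaloisExtension
import Literature.NumberTheory.NumberFields.AlgClosureCubeRootsOfUnity
import HarnessLib

/-!
# Route `PrintCFram`, crux C2 `BottomClassIndexLawFiveLe` (stmt-BirchSwinnertonDyer-20372), line
# `eisenstein-resource-bdp-line` v10, Stub H — the REFLECTION STEP as theorems, part 3 (R-HCF): a `σ`-stable subgroup `S ≤ Cl_K` with
# `σ` acting on `Cl_K/S` by `c ↦ c^{m⁻¹}` gives, through the tree's HILBERT CLASS FIELD, an unramified abelian `M_S ⊆ K̄` over `K`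
# together with a lift `g ∈ Aut(K̄/ℚ)` of `σ` which stabilises `M_S` and normalises `Gal(M_S/K)` by `τ ↦ τ^m` (`τ g = g τ^m`)
# (cell `bsd-print-cfram`, seat `bsd-line-cfram-p1-w8` g0; helper `--supports` 20372; 0 facts, 0 defs)

HONEST FRAMING. Nothing about BSD is proved here. Third file of the «reflection as theorems» track
(`Cruxes/BottomClassIndexLawFiveLe/Lines/eisenstein-resource-bdp-line-w8g0-notes.md` §3): the class-field-theoretic input «a
`χ̄`-quotient of `Cl_K` is an unramified cyclic extension on which `Gal(K/ℚ)` acts through `χ̄`» of Leopoldt's reflection theorem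
(Washington §10.2: "By class field theory, `G ≃ C(p)`"; Lang Ch. 13 §2), on the tree's PROVED Hilbert class field
(`hilbertClassField K`, `artinEquiv : Cl(𝓞 K) ≃* Gal(H/K)`, the class fields `classFieldOfSubgroup K S = H^{artinEquiv(S)}`,
the equivariance `artinEquiv (σ•c) = τ̃ ∘ artinEquiv c ∘ τ̃⁻¹` of `HilbertClassFieldArtinEquivariance.lean`, and `H/ℚ` Galois for
`K/ℚ` Galois, `HilbertClassFieldOfGaloisExtension.lean`). Output shape = the hypotheses `hgM`, `hrel` of part 1
(`…HerbrandKummerEquivariance.exists_apply_radicand_eq_pow_mul_pow`).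

* `exists_mem_smul_eq_of_forall_smul_mem` — a `σ`-stable subgroup of the (finite) class group is `σ`-invariant: `σ•S = S`.
* `coe_restrict_apply` — the restriction `π : Gal(H/K) → Gal(M_S/K)` of `HilbertClassFieldCorrespondence.exists_restrict` acts on
  `M_S ⊆ H` as `φ` does.
* **`exists_lift_stabilising_classField`** — `K/ℚ` Galois, `σ ∈ Gal(K/ℚ)`, `S ≤ Cl(𝓞 K)` with `σ•S ⊆ S` and `(σ•c)^m · c⁻¹ ∈ S`
  for all `c` ⟹ ∃ `g : K̄ ≃ₐ[ℚ] K̄` with `g|_K = σ`, `g(M_S) ⊆ M_S`, and `τ (g x) = g (τ^m x)` for all `τ ∈ Gal(M_S/K)`, `x ∈ M_S`.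

THEOREMS ONLY; no definition, no named fact, no `sorry`; imports no `Theses` module. BSD is not proved by any of this; no summit
statement is proved by this seat.
References: [Washington1997] §10.2 (proof of Thm. 10.9); [Lang1990] Ch. 13 §2 Thm. 2.1 (proof: "By class field theory, `G ≈ C(p)` and
`G⁺ ≈ C(p)⁺`"); [NeukirchANT1999] Ch. VI §7 (7.1), Ch. IV §6 (functoriality of the Artin symbol).
-/

set_option autoImplicit false
-- `…BirchSwinnertonDyer.BirchSwinnertonDyer.Theorems…` is the problem's mandated namespace (D-0017).
set_option linter.dupNamespace false

noncomputable section

namespace Summit.BirchSwinnertonDyer.BirchSwinnertonDyer.Theorems.PrintCFram.HerbrandKummer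

open Literature.NumberTheory.NumberFields Literature.NumberTheory.NumberFields.hilbertClassField
open Literature.NumberTheory.GaloisRepresentations NumberField IsDedekindDomain Module IntermediateField
open scoped nonZeroDivisors

section ClassField

variable (K : Type) [Field K] [NumberField K]

/-- A `σ`-stable subgroup `S` of the (finite) class group is `σ`-invariant: every element of `S` is `σ • c'` for some `c' ∈ S`
(injective self-map of a finite set). [folklore] -/
theorem exists_mem_smul_eq_of_forall_smul_mem (e : ClassGroup (𝓞 K) ≃* ClassGroup (𝓞 K)) (S : Subgroup (ClassGroup (𝓞 K)))
    (hS : ∀ c ∈ S, e c ∈ S) {c : ClassGroup (𝓞 K)} (hc : c ∈ S) : ∃ c' ∈ S, e c' = c := by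
  classical
  let f : S → S := fun x => ⟨e x, hS x x.2⟩
  have hf : Function.Injective f := fun x y h => Subtype.ext (e.injective (congrArg Subtype.val h))
  obtain ⟨x, hx⟩ := (Finite.injective_iff_surjective.mp hf) ⟨c, hc⟩
  exact ⟨x, x.2, congrArg Subtype.val hx⟩

/-- The restriction `π : Gal(H/K) → Gal(M_S/K)` of `exists_restrict` acts on `M_S ⊆ H` as `φ` does:
`(π φ) x = φ x` in `K̄`. [cite: Cox2013, §5.C Cor. 5.24] -/
theorem coe_restrict_apply (S : Subgroup (ClassGroup (𝓞 K)))
    {π : (hilbertClassField K ≃ₐ[K] hilbertClassField K) →*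
      (classFieldOfSubgroup K S ≃ₐ[K] classFieldOfSubgroup K S)}
    (hπ : ∀ γ : Field.absoluteGaloisGroup K,
      π (absRestrictNormalHom (hilbertClassField K) γ) = absRestrictNormalHom (classFieldOfSubgroup K S) γ)
    (φ : hilbertClassField K ≃ₐ[K] hilbertClassField K) (x : classFieldOfSubgroup K S) :
    ((π φ x : classFieldOfSubgroup K S) : AlgebraicClosure K) =
      ((φ ⟨x, classFieldOfSubgroup_le K S x.2⟩ : hilbertClassField K) : AlgebraicClosure K) := by
  obtain ⟨γ, rfl⟩ := absRestrictNormalHom_surjective (hilbertClassField K) φ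
  rw [hπ]
  have h1 : ((absRestrictNormalHom (classFieldOfSubgroup K S) γ x : classFieldOfSubgroup K S) : AlgebraicClosure K) =
      γ • (x : AlgebraicClosure K) := AlgEquiv.restrictNormalHom_apply (classFieldOfSubgroup K S) _ x
  have h2 : ((absRestrictNormalHom (hilbertClassField K) γ ⟨x, classFieldOfSubgroup_le K S x.2⟩ : hilbertClassField K) :
      AlgebraicClosure K) = γ • (x : AlgebraicClosure K) :=
    AlgEquiv.restrictNormalHom_apply (hilbertClassField K) _ ⟨x, classFieldOfSubgroup_le K S x.2⟩
  rw [h1, h2]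

variable [IsGalois ℚ K]

/-- **The class field of a `σ`-stable subgroup is stabilised by a lift of `σ`, which normalises its Galois group as `σ` acts on
`Cl_K/S`.** Let `K/ℚ` be Galois, `σ ∈ Gal(K/ℚ)`, `S ≤ Cl(𝓞 K)` with `σ • S ⊆ S` (`σ • c = ClassGroup.mulEquiv (intAut σ) c`) and
`(σ • c)^m · c⁻¹ ∈ S` for every class `c`. Then there is `g ∈ Aut(K̄/ℚ)` with `g|_K = σ`, `g(M_S) ⊆ M_S` for the class field
`M_S = H^{artinEquiv(S)} ⊆ K̄` of `S`, and `τ (g x) = g (τ^m x)` for every `τ ∈ Gal(M_S/K)` and `x ∈ M_S` (i.e. `g⁻¹ τ g = τ^m`).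
Mechanism: `H/ℚ` is Galois, so `g(H) = H` and `τ̃ = g|_H`; Artin equivariance `artinEquiv (σ•c) = τ̃ artinEquiv(c) τ̃⁻¹`; `S` is
`σ`-invariant, so `τ̃` preserves the fixed field of `artinEquiv(S)`; and `artinEquiv(c) τ̃ = τ̃ artinEquiv(σ⁻¹•c)` with
`σ⁻¹•c ≡ c^m (mod S)` on `M_S`. [cite: Washington1997, §10.2 (proof of Thm. 10.9: "By class field theory …")]
[cite: Lang1990, Ch. 13 §2 Thm. 2.1 (proof)] [cite: NeukirchANT1999, Ch. VI §7 Thm. (7.1) and Ch. IV §6] -/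
theorem exists_lift_stabilising_classField (σ : K ≃ₐ[ℚ] K) (S : Subgroup (ClassGroup (𝓞 K))) (m : ℕ)
    (hS : ∀ c ∈ S, ClassGroup.mulEquiv (AmbiguousClass.intAut σ) c ∈ S)
    (hact : ∀ c : ClassGroup (𝓞 K), (ClassGroup.mulEquiv (AmbiguousClass.intAut σ) c) ^ m * c⁻¹ ∈ S) :
    ∃ (g : AlgebraicClosure K ≃ₐ[ℚ] AlgebraicClosure K)
      (hgM : ∀ x : AlgebraicClosure K, x ∈ classFieldOfSubgroup K S → g x ∈ classFieldOfSubgroup K S),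
      (∀ x : K, g (algebraMap K (AlgebraicClosure K) x) = algebraMap K (AlgebraicClosure K) (σ x)) ∧
      ∀ (τ : classFieldOfSubgroup K S ≃ₐ[K] classFieldOfSubgroup K S) (x : classFieldOfSubgroup K S),
        ((τ ⟨g x, hgM x x.2⟩ : classFieldOfSubgroup K S) : AlgebraicClosure K) =
          g (((τ ^ m) x : classFieldOfSubgroup K S) : AlgebraicClosure K) := by
  classical
  set H := hilbertClassField K with hHdef
  set M := classFieldOfSubgroup K S with hMdef
  -- lift `σ` to `g ∈ Aut(K̄/ℚ)`
  haveI : Normal ℚ (AlgebraicClosure K) := normal_rat_algebraicClosure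
  let g : AlgebraicClosure K ≃ₐ[ℚ] AlgebraicClosure K := σ.liftNormal (AlgebraicClosure K)
  have hgK : ∀ x : K, g (algebraMap K (AlgebraicClosure K) x) = algebraMap K (AlgebraicClosure K) (σ x) :=
    AlgEquiv.liftNormal_commutes σ (AlgebraicClosure K)
  -- `g(H) ⊆ H`
  have hgH : ∀ y : AlgebraicClosure K, y ∈ H → g y ∈ H := by
    intro y hy
    have h := hilbertClassField.map_algEquiv_le (K := ℚ) K g
    exact h ⟨y, hy, rfl⟩
  -- `τ̃ = g|_H : H ≃ₐ[ℚ] H`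
  haveI : Normal ℚ H := IntermediateField.restrictScalars_normal.mp (hilbertClassField.normal_restrictScalars (K := ℚ) K)
  let τH : H ≃ₐ[ℚ] H := g.restrictNormal H
  have hτH : ∀ y : H, ((τH y : H) : AlgebraicClosure K) = g y := fun y =>
    AlgEquiv.restrictNormal_commutes g H y
  have hτHK : ∀ x : K, τH (algebraMap K H x) = algebraMap K H (σ x) := by
    intro x
    apply Subtype.ext
    rw [hτH]
    exact hgK x
  have hτHsymm : ∀ y : H, ((τH.symm y : H) : AlgebraicClosure K) = g.symm y := by
    intro y
    apply g.injective
    rw [← hτH, AlgEquiv.apply_symm_apply, AlgEquiv.apply_symm_apply]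
  -- Artin equivariance with `τ̃`
  have hequiv : ∀ (c : ClassGroup (𝓞 K)) (y : H),
      artinEquiv K (ClassGroup.mulEquiv (AmbiguousClass.intAut σ) c) y = τH (artinEquiv K c (τH.symm y)) :=
    fun c y => artinEquiv_mulEquiv_intAut_apply K τH σ hτHK c y
  -- `τ̃` preserves the fixed field of `artinEquiv(S)`
  have hfix : ∀ y : H, y ∈ IntermediateField.fixedField (galSubgroup K S) →
      τH y ∈ IntermediateField.fixedField (galSubgroup K S) := by
    intro y hy
    rw [IntermediateField.mem_fixedField_iff] at hy ⊢
    intro φ hφ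
    rw [mem_galSubgroup_iff] at hφ
    -- `φ = artinEquiv c`, `c ∈ S`, `c = σ • c'` with `c' ∈ S`
    obtain ⟨c', hc', hc'eq⟩ := exists_mem_smul_eq_of_forall_smul_mem K
      (ClassGroup.mulEquiv (AmbiguousClass.intAut σ)) S hS hφ
    have hφeq : φ = artinEquiv K (ClassGroup.mulEquiv (AmbiguousClass.intAut σ) c') := by
      rw [hc'eq, MulEquiv.apply_symm_apply]
    rw [hφeq, hequiv, AlgEquiv.symm_apply_apply,
      hy _ ((artinEquiv_mem_galSubgroup_iff K S c').mpr hc')]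
  -- `g(M) ⊆ M`
  have hgM : ∀ x : AlgebraicClosure K, x ∈ M → g x ∈ M := by
    intro x hx
    have hxH : x ∈ H := classFieldOfSubgroup_le K S hx
    have hxfix : (⟨x, hxH⟩ : H) ∈ IntermediateField.fixedField (galSubgroup K S) :=
      (IntermediateField.mem_lift (⟨x, hxH⟩ : H)).mp hx
    have h1 := (IntermediateField.mem_lift (τH ⟨x, hxH⟩)).mpr (hfix _ hxfix)
    rwa [hτH] at h1
  refine ⟨g, hgM, hgK, ?_⟩
  -- the relation `τ (g x) = g (τ^m x)`
  obtain ⟨π, hπsurj, hπ, hker⟩ := exists_restrict K S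
  intro τ x
  obtain ⟨φ, rfl⟩ := hπsurj τ
  obtain ⟨c, rfl⟩ := (artinEquiv K).surjective φ
  have hxH : (x : AlgebraicClosure K) ∈ H := classFieldOfSubgroup_le K S x.2
  have hgxH : g x ∈ H := hgH _ hxH
  rw [← map_pow, ← map_pow, coe_restrict_apply K S hπ, coe_restrict_apply K S hπ]
  -- `artinEquiv c (g x) = τ̃ (artinEquiv (σ⁻¹•c) x)`; and `σ • (c^m) ≡ c (mod S)` after applying the equivariance
  have hxfix : (⟨x, hxH⟩ : H) ∈ IntermediateField.fixedField (galSubgroup K S) :=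
    (IntermediateField.mem_lift (⟨(x : AlgebraicClosure K), hxH⟩ : H)).mp x.2
  -- rewrite `c = (σ•c^m) * s` with `s ∈ S`
  have hs : (ClassGroup.mulEquiv (AmbiguousClass.intAut σ) (c ^ m))⁻¹ * c ∈ S := by
    have h := S.inv_mem (hact c)
    rwa [mul_inv_rev, inv_inv, ← map_pow, mul_comm] at h
  set s := (ClassGroup.mulEquiv (AmbiguousClass.intAut σ) (c ^ m))⁻¹ * c with hsdef
  have hc : c = ClassGroup.mulEquiv (AmbiguousClass.intAut σ) (c ^ m) * s := by
    rw [hsdef, mul_inv_cancel_left]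
  have hsfix : artinEquiv K s (τH ⟨x, hxH⟩) = τH ⟨x, hxH⟩ := by
    have h := hfix _ hxfix
    rw [IntermediateField.mem_fixedField_iff] at h
    exact h _ ((artinEquiv_mem_galSubgroup_iff K S s).mpr hs)
  have hgx : (⟨g x, hgxH⟩ : H) = τH ⟨x, hxH⟩ := Subtype.ext (by rw [hτH])
  rw [hgx]
  conv_lhs => rw [hc, map_mul, AlgEquiv.mul_apply, hsfix, hequiv, AlgEquiv.symm_apply_apply]
  rw [hτH]

end ClassField

end Summit.BirchSwinnertonDyer.BirchSwinnertonDyer.Theorems.PrintCFram.HerbrandKummer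

end
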